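import Summits.QuantumFields.YangMills.Theorems.SwapVirialDeficitSigmaTwistedLetterCeilingShells
import Summits.QuantumFields.YangMills.Theorems.UV3WindowNetSU2
import Summits.QuantumFields.YangMills.Theorems.ToronSmallBallOwnAxisShiftLocal
import HarnessLib

/-!
# The σ-twisted four-leader small ball, CEILING side — III: Haar-side pieces

(Overview of the four-file chain `…SigmaTwistedLetterCeiling{Algebra,Shells,Haar,}.lean` and of the reduction — slaved letter, region A by
the three-letter ceiling, region B by the four load-bearing constraints and dyadic shells against slabs — in the header of part I,
`SwapVirialDeficitSigmaTwistedLetterCeilingAlgebra.lean`.)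

This file: §5 — the slab `Haar{|re q(U)| ≤ s} ≤ 16c·s`, the small ball around ANY point `Haar{‖q(U) − q(P)‖ ≤ ρ} ≤ 32ρ³` (left translation +
✓`haarProbability_su2_two_sub_trace_lt_le`), the pull-back of the two inner letters to the ball model (normalising letters of norm `< 1` only
enlarges the four constraints), and ★★ `haar_two_constraints_le`: the Haar² mass of the inner pair at a fixed outer letter.
HONEST LABEL: finite-dimensional Haar-volume bookkeeping toward the fixed-`L` zero-mode factor of the swap-glued femto ring (a prediction row of a
DRAFT line); nothing about ⟨24197⟩/⟨24194⟩/⟨24497⟩ or any rung is proved; the Yang–Mills mass gap is NOT proved; no summit is proved by a line.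
Seat ym-line-sfw-p2 g93 (LEAD of unit sfw-p2, free hands; `--supports stmt-QuantumFields-24197`).  THEOREMS ONLY (0 `def`, 0 `sorry`),
standard axioms.  References: [cite: Vanbaal2001]; [cite: Luscher1983, §2]; [cite: GonzalezarroyoAltes1988]; [folklore].
-/

set_option autoImplicit false

noncomputable section

open MeasureTheory Quaternion Set
open scoped Quaternion ENNReal BigOperators
open Literature.MathematicalPhysics.QuantumLattice
open Literature.MathematicalPhysics.QuantumFieldTheory (haarProbability)
open Summit.QuantumFields.YangMills.Theorems.SwapTwistDeficit.ToronLog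
open Summit.QuantumFields.YangMills.Theorems.ToronValleyVolume.NearlyCommutingCeiling
open Summit.QuantumFields.YangMills.Theorems.SwapVirialDeficit
open Summit.QuantumFields.YangMills.Theorems.UV3WindowNetSU2 (abs_imI_le_norm abs_imJ_le_norm abs_imK_le_norm)

namespace Summit.QuantumFields.YangMills.Theorems.SwapVirialDeficit.SigmaTwistedCeiling

/-! ## §5 Haar-side pieces: slabs `|re q| ≤ s`, small balls, and the two inner letters at a fixed outer letter -/

section HaarSide

attribute [local instance] Literature.Analysis.FluidPDE.Tao2016.quatMeasurableSpace
  Literature.Analysis.FluidPDE.Tao2016.quatBorelSpace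
  Literature.MathematicalPhysics.QuantumLattice.secondCountableTopology_su2

/-- The cone measure lives on the open unit ball. [folklore] -/
theorem coneMeasure_compl_ball : coneMeasure (Metric.ball (0 : ℍ) 1)ᶜ = 0 := by
  rw [coneMeasure, Measure.smul_apply, Measure.restrict_apply measurableSet_ball.compl, Set.compl_inter_self, measure_empty,
    smul_zero]

/-- ★ **Slab bound**: `Haar{U ∈ SU(2) | |re q(U)| ≤ s} ≤ 16c·s` (`0 ≤ s`): the cone over the slab lies in the coordinate box
`[-s,s] × [-1,1]³`. [folklore] -/
theorem haar_absRe_le (s : ℝ) (hs : 0 ≤ s) :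
    haarProbability (Matrix.specialUnitaryGroup (Fin 2) ℂ) {U | |(su2Quat U).re| ≤ s} ≤ ENNReal.ofReal (coneConst * (16 * s)) := by
  have hm : MeasurableSet {U : Matrix.specialUnitaryGroup (Fin 2) ℂ | |(su2Quat U).re| ≤ s} :=
    measurableSet_le ((Quaternion.continuous_re.comp
      Literature.MathematicalPhysics.QuantumFieldTheory.Balaban1983to89.T4HaarSU2Translate.continuous_su2Quat).abs.measurable)
      measurable_const
  rw [← measurePreserving_quatToSU2.measure_preimage hm.nullMeasurableSet]
  have hsub : quatToSU2 ⁻¹' {U : Matrix.specialUnitaryGroup (Fin 2) ℂ | |(su2Quat U).re| ≤ s} ⊆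
      quatBox ![-s, -1, -1, -1] ![s, 1, 1, 1] ∪ (Metric.ball (0 : ℍ) 1)ᶜ := by
    intro x hx
    simp only [Set.mem_preimage, Set.mem_setOf_eq] at hx
    by_cases hb : x ∈ Metric.ball (0 : ℍ) 1
    · left
      rw [Metric.mem_ball, dist_zero_right] at hb
      have hre : |x.re| ≤ s := by
        by_cases h0 : x = 0
        · rw [h0]; simpa using hs
        · rw [Literature.MathematicalPhysics.QuantumFieldTheory.Balaban1983to89.T4HaarSU2Translate.su2Quat_quatToSU2 h0,
            Quaternion.re_smul, smul_eq_mul, abs_mul, abs_inv, abs_of_pos (norm_pos_iff.2 h0)] at hx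
          have h1 : 1 ≤ ‖x‖⁻¹ := (one_le_inv₀ (norm_pos_iff.2 h0)).2 hb.le
          nlinarith [abs_nonneg x.re]
      have hre' := abs_le.1 hre
      have hI := abs_le.1 ((abs_imI_le_norm x).trans hb.le)
      have hJ := abs_le.1 ((abs_imJ_le_norm x).trans hb.le)
      have hK := abs_le.1 ((abs_imK_le_norm x).trans hb.le)
      simp only [quatBox, Set.mem_setOf_eq, Matrix.cons_val_zero, Matrix.cons_val_one, Matrix.cons_val]
      exact ⟨hre'.1, hre'.2, hI.1, hI.2, hJ.1, hJ.2, hK.1, hK.2⟩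
    · exact Or.inr hb
  refine (measure_mono hsub).trans ((measure_union_le _ _).trans ?_)
  rw [coneMeasure_compl_ball, add_zero]
  refine (coneMeasure_le_mul_volume _).trans ?_
  rw [volume_quatBox (by intro i; fin_cases i <;> (simp; try linarith)), ← ENNReal.ofReal_mul coneConst_pos.le]
  refine ENNReal.ofReal_le_ofReal (le_of_eq ?_)
  simp only [Matrix.cons_val_zero, Matrix.cons_val_one, Matrix.cons_val]
  ring

/-- ★ **Small balls from above, around any point**: `Haar{U | ‖q(U) − q(P)‖ ≤ ρ} ≤ 32ρ³` for `0 < ρ` (left translation to `P = 1`, then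
✓`haarProbability_su2_two_sub_trace_lt_le` with `r = 2ρ`). [folklore] -/
theorem haar_ball_le (P : Matrix.specialUnitaryGroup (Fin 2) ℂ) {ρ : ℝ} (hρ : 0 < ρ) :
    haarProbability (Matrix.specialUnitaryGroup (Fin 2) ℂ) {U | ‖su2Quat U - su2Quat P‖ ≤ ρ} ≤ ENNReal.ofReal (32 * ρ ^ 3) := by
  haveI : (haarProbability (Matrix.specialUnitaryGroup (Fin 2) ℂ)).IsMulLeftInvariant := by
    rw [haarProbability_su2_eq_su2BallMeasure]; infer_instance
  have e : {U : Matrix.specialUnitaryGroup (Fin 2) ℂ | ‖su2Quat U - su2Quat P‖ ≤ ρ} =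
      (fun U => P⁻¹ * U) ⁻¹' {V | ‖su2Quat V - 1‖ ≤ ρ} := by
    ext U
    simp only [Set.mem_setOf_eq, Set.mem_preimage]
    have h : su2Quat U - su2Quat P = su2Quat P * (su2Quat (P⁻¹ * U) - 1) := by
      rw [mul_sub, mul_one,
        ← Literature.MathematicalPhysics.QuantumFieldTheory.Balaban1983to89.T4HaarSU2Translate.su2Quat_mul, mul_inv_cancel_left]
    rw [h, norm_mul, norm_su2Quat, one_mul]
  rw [e, measure_preimage_mul]
  have hsub : {V : Matrix.specialUnitaryGroup (Fin 2) ℂ | ‖su2Quat V - 1‖ ≤ ρ} ⊆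
      {V | 2 - ((V : Matrix (Fin 2) (Fin 2) ℂ).trace).re < (2 * ρ) ^ 2} := by
    intro V hV
    simp only [Set.mem_setOf_eq] at hV ⊢
    rw [FemtoTransferGap.OwnAxis.two_sub_re_trace_eq_norm_sq]
    nlinarith [norm_nonneg (su2Quat V - 1)]
  refine (measure_mono hsub).trans ((haarProbability_su2_two_sub_trace_lt_le (by positivity)).trans (le_of_eq ?_))
  congr 1; ring

/-- Letter-wise radial projection `ℍ² → SU(2)²` maps the product cone measure to product Haar measure. [folklore] -/
theorem measurePreserving_proj_two :
    MeasurePreserving (fun (x : Fin 2 → ℍ) (μ : Fin 2) => quatToSU2 (x μ)) (Measure.pi fun _ : Fin 2 => coneMeasure)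
      (Measure.pi fun _ : Fin 2 => haarProbability (Matrix.specialUnitaryGroup (Fin 2) ℂ)) :=
  measurePreserving_pi (fun _ : Fin 2 => coneMeasure) (fun _ : Fin 2 => haarProbability (Matrix.specialUnitaryGroup (Fin 2) ℂ))
    fun _ => measurePreserving_quatToSU2

/-- The product cone measure (two letters) gives full mass to the product of unit balls. [folklore] -/
theorem pi_coneMeasure_compl_piBall_two :
    (Measure.pi fun _ : Fin 2 => coneMeasure) (Set.pi Set.univ (fun _ : Fin 2 => Metric.ball (0 : ℍ) 1))ᶜ = 0 := by
  haveI := isProbabilityMeasure_coneMeasure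
  have hball : coneMeasure (Metric.ball (0 : ℍ) 1) = 1 := by
    rw [coneMeasure_apply measurableSet_ball subset_rfl, ENNReal.inv_mul_cancel volume_ball_quat_ne_zero volume_ball_quat_ne_top]
  have h1 : (Measure.pi fun _ : Fin 2 => coneMeasure) (Set.pi Set.univ (fun _ : Fin 2 => Metric.ball (0 : ℍ) 1)) = 1 := by
    rw [Measure.pi_pi]; simp [hball]
  rw [measure_compl (MeasurableSet.univ_pi fun _ => measurableSet_ball) (measure_ne_top _ _), h1, measure_univ, tsub_self]

/-- Normalising a letter of the unit ball enlarges its commutator with a fixed quaternion. [folklore] -/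
theorem norm_comm_le_norm_comm_normalised (a : ℍ) {x : ℍ} (hx : ‖x‖ < 1) :
    ‖a * x - x * a‖ ≤ ‖a * su2Quat (quatToSU2 x) - su2Quat (quatToSU2 x) * a‖ := by
  by_cases h0 : x = 0
  · rw [h0, mul_zero, zero_mul, sub_zero, norm_zero]; exact norm_nonneg _
  rw [Literature.MathematicalPhysics.QuantumFieldTheory.Balaban1983to89.T4HaarSU2Translate.su2Quat_quatToSU2 h0, mul_smul_comm,
    smul_mul_assoc, ← smul_sub, norm_smul, Real.norm_eq_abs, abs_of_pos (inv_pos.2 (norm_pos_iff.2 h0))]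
  have h1 : 1 ≤ ‖x‖⁻¹ := (one_le_inv₀ (norm_pos_iff.2 h0)).2 hx.le
  nlinarith [norm_nonneg (a * x - x * a)]

/-- Normalising enlarges the commutator of a letter with its conjugate. [folklore] -/
theorem norm_comm_conj_le_normalised (a : ℍ) {x : ℍ} (hx : ‖x‖ < 1) :
    ‖x * (star a * x * a) - (star a * x * a) * x‖ ≤
      ‖su2Quat (quatToSU2 x) * (star a * su2Quat (quatToSU2 x) * a) - (star a * su2Quat (quatToSU2 x) * a) * su2Quat (quatToSU2 x)‖ := by
  by_cases h0 : x = 0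
  · rw [h0]; simp
  rw [Literature.MathematicalPhysics.QuantumFieldTheory.Balaban1983to89.T4HaarSU2Translate.su2Quat_quatToSU2 h0]
  set c := ‖x‖⁻¹ with hc
  have e : (c • x) * (star a * (c • x) * a) - (star a * (c • x) * a) * (c • x) = (c * c) • (x * (star a * x * a) - (star a * x * a) * x) := by
    rw [mul_smul_comm, smul_mul_assoc, smul_mul_assoc, mul_smul_comm, smul_smul, mul_smul_comm, smul_mul_assoc, smul_smul, smul_sub]
  rw [e, norm_smul, Real.norm_eq_abs, abs_of_pos (by rw [hc]; have := norm_pos_iff.2 h0; positivity)]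
  have h1 : 1 ≤ c := (one_le_inv₀ (norm_pos_iff.2 h0)).2 hx.le
  have h2 : 1 ≤ c * c := one_le_mul_of_one_le_of_one_le h1 h1
  nlinarith [norm_nonneg (x * (star a * x * a) - (star a * x * a) * x)]

/-- Normalising both letters enlarges their commutator (✓`norm_comm_smul`). [folklore] -/
theorem norm_comm_le_normalised₂ {x y : ℍ} (hx : ‖x‖ < 1) (hy : ‖y‖ < 1) :
    ‖x * y - y * x‖ ≤ ‖su2Quat (quatToSU2 x) * su2Quat (quatToSU2 y) - su2Quat (quatToSU2 y) * su2Quat (quatToSU2 x)‖ := by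
  by_cases hx0 : x = 0
  · rw [hx0, zero_mul, mul_zero, sub_zero, norm_zero]; exact norm_nonneg _
  by_cases hy0 : y = 0
  · rw [hy0, zero_mul, mul_zero, sub_zero, norm_zero]; exact norm_nonneg _
  rw [Literature.MathematicalPhysics.QuantumFieldTheory.Balaban1983to89.T4HaarSU2Translate.su2Quat_quatToSU2 hx0,
    Literature.MathematicalPhysics.QuantumFieldTheory.Balaban1983to89.T4HaarSU2Translate.su2Quat_quatToSU2 hy0,
    norm_comm_smul, abs_of_pos (inv_pos.2 (norm_pos_iff.2 hx0)), abs_of_pos (inv_pos.2 (norm_pos_iff.2 hy0))]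
  have ha : 1 ≤ ‖x‖⁻¹ := (one_le_inv₀ (norm_pos_iff.2 hx0)).2 hx.le
  have hb : 1 ≤ ‖y‖⁻¹ := (one_le_inv₀ (norm_pos_iff.2 hy0)).2 hy.le
  have hab : 1 ≤ ‖x‖⁻¹ * ‖y‖⁻¹ := one_le_mul_of_one_le_of_one_le ha hb
  nlinarith [norm_nonneg (x * y - y * x)]

/-- ★★ **The two inner letters at a fixed outer letter, Haar side.**  For `P ∈ SU(2)` with `|re q(P)| < 1/2`, `0 ≤ t`, `(1/2)^{K+1} ≤ t`:
`Haar²{(Q₀, Q₁) | (b), (c), (d), (a) at q₃ = q(P)} ≤ Σ_{k ≤ K} 𝟙{|re q(P)| ≤ 2t·2^{k+1}}·c²·2048t⁴ + c²·256t⁴`. [folklore] -/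
theorem haar_two_constraints_le (P : Matrix.specialUnitaryGroup (Fin 2) ℂ) {t : ℝ} {K : ℕ} (hr : |(su2Quat P).re| < 1 / 2)
    (ht : 0 ≤ t) (hK : (1 / 2 : ℝ) ^ (K + 1) ≤ t) :
    (Measure.pi fun _ : Fin 2 => haarProbability (Matrix.specialUnitaryGroup (Fin 2) ℂ))
        {Q : Fin 2 → Matrix.specialUnitaryGroup (Fin 2) ℂ |
          ‖su2Quat P * su2Quat (Q 1) - su2Quat (Q 1) * su2Quat P‖ ≤ t ∧
          |(su2Quat P).re| * ‖su2Quat P * su2Quat (Q 0) - su2Quat (Q 0) * su2Quat P‖ ≤ 2 * t ∧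
          ‖su2Quat (Q 0) * (star (su2Quat P) * su2Quat (Q 0) * su2Quat P) -
              (star (su2Quat P) * su2Quat (Q 0) * su2Quat P) * su2Quat (Q 0)‖ ≤ 3 * t ∧
          ‖su2Quat (Q 0) * su2Quat (Q 1) - su2Quat (Q 1) * su2Quat (Q 0)‖ ≤ t} ≤
      (∑ k ∈ Finset.range (K + 1),
          {q : ℍ | |q.re| ≤ 2 * t * 2 ^ (k + 1)}.indicator (fun _ => ENNReal.ofReal (coneConst ^ 2 * (2048 * t ^ 4))) (su2Quat P)) +
        ENNReal.ofReal (coneConst ^ 2 * (256 * t ^ 4)) := by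
  set q₃ := su2Quat P with hq₃
  have h₃ : ‖q₃‖ = 1 := norm_su2Quat P
  have hq : Measurable (su2Quat : Matrix.specialUnitaryGroup (Fin 2) ℂ → ℍ) :=
    Literature.MathematicalPhysics.QuantumFieldTheory.Balaban1983to89.T4HaarSU2Translate.measurable_su2Quat
  have hq0 : Measurable fun Q : Fin 2 → Matrix.specialUnitaryGroup (Fin 2) ℂ => su2Quat (Q 0) := hq.comp (measurable_pi_apply 0)
  have hq1 : Measurable fun Q : Fin 2 → Matrix.specialUnitaryGroup (Fin 2) ℂ => su2Quat (Q 1) := hq.comp (measurable_pi_apply 1)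
  set T : Set (Fin 2 → Matrix.specialUnitaryGroup (Fin 2) ℂ) := {Q |
      ‖q₃ * su2Quat (Q 1) - su2Quat (Q 1) * q₃‖ ≤ t ∧ |q₃.re| * ‖q₃ * su2Quat (Q 0) - su2Quat (Q 0) * q₃‖ ≤ 2 * t ∧
      ‖su2Quat (Q 0) * (star q₃ * su2Quat (Q 0) * q₃) - (star q₃ * su2Quat (Q 0) * q₃) * su2Quat (Q 0)‖ ≤ 3 * t ∧
      ‖su2Quat (Q 0) * su2Quat (Q 1) - su2Quat (Q 1) * su2Quat (Q 0)‖ ≤ t} with hT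
  have hA : MeasurableSet {Q : Fin 2 → Matrix.specialUnitaryGroup (Fin 2) ℂ | ‖q₃ * su2Quat (Q 1) - su2Quat (Q 1) * q₃‖ ≤ t} :=
    measurableSet_le ((measurable_const.mul hq1).sub (hq1.mul measurable_const)).norm measurable_const
  have hB' : MeasurableSet {Q : Fin 2 → Matrix.specialUnitaryGroup (Fin 2) ℂ |
      |q₃.re| * ‖q₃ * su2Quat (Q 0) - su2Quat (Q 0) * q₃‖ ≤ 2 * t} :=
    measurableSet_le (measurable_const.mul ((measurable_const.mul hq0).sub (hq0.mul measurable_const)).norm) measurable_const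
  have hC : MeasurableSet {Q : Fin 2 → Matrix.specialUnitaryGroup (Fin 2) ℂ |
      ‖su2Quat (Q 0) * (star q₃ * su2Quat (Q 0) * q₃) - (star q₃ * su2Quat (Q 0) * q₃) * su2Quat (Q 0)‖ ≤ 3 * t} :=
    measurableSet_le ((hq0.mul ((measurable_const.mul hq0).mul measurable_const)).sub
      (((measurable_const.mul hq0).mul measurable_const).mul hq0)).norm measurable_const
  have hD : MeasurableSet {Q : Fin 2 → Matrix.specialUnitaryGroup (Fin 2) ℂ |
      ‖su2Quat (Q 0) * su2Quat (Q 1) - su2Quat (Q 1) * su2Quat (Q 0)‖ ≤ t} :=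
    measurableSet_le ((hq0.mul hq1).sub (hq1.mul hq0)).norm measurable_const
  have hTm : MeasurableSet T := by
    rw [hT, Set.setOf_and, Set.setOf_and, Set.setOf_and]
    exact hA.inter (hB'.inter (hC.inter hD))
  rw [← measurePreserving_proj_two.measure_preimage hTm.nullMeasurableSet]
  -- pull back into the ball model
  set Pre := (fun (x : Fin 2 → ℍ) (μ : Fin 2) => quatToSU2 (x μ)) ⁻¹' T with hPre
  set B := Set.pi Set.univ (fun _ : Fin 2 => Metric.ball (0 : ℍ) 1) with hB
  have hsub : Pre ∩ B ⊆ {x : Fin 2 → ℍ | (∀ j, ‖x j‖ < 1) ∧ ‖q₃ * x 1 - x 1 * q₃‖ ≤ t ∧ |q₃.re| * ‖q₃ * x 0 - x 0 * q₃‖ ≤ 2 * t ∧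
      ‖x 0 * (star q₃ * x 0 * q₃) - (star q₃ * x 0 * q₃) * x 0‖ ≤ 3 * t ∧ ‖x 0 * x 1 - x 1 * x 0‖ ≤ t} := by
    intro x hx
    rw [hPre, hB, hT] at hx
    simp only [Set.mem_inter_iff, Set.mem_preimage, Set.mem_setOf_eq, Set.mem_pi, Set.mem_univ, true_implies, Metric.mem_ball,
      dist_zero_right] at hx
    obtain ⟨⟨hb, hc, hd, ha⟩, hball⟩ := hx
    refine ⟨hball, (norm_comm_le_norm_comm_normalised q₃ (hball 1)).trans hb, ?_, (norm_comm_conj_le_normalised q₃ (hball 0)).trans hd,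
      (norm_comm_le_normalised₂ (hball 0) (hball 1)).trans ha⟩
    exact (mul_le_mul_of_nonneg_left (norm_comm_le_norm_comm_normalised q₃ (hball 0)) (abs_nonneg _)).trans hc
  calc (Measure.pi fun _ : Fin 2 => coneMeasure) Pre
      ≤ (Measure.pi fun _ : Fin 2 => coneMeasure) (Pre ∩ B ∪ Bᶜ) := measure_mono (fun x hx => by
          by_cases hb : x ∈ B
          · exact Or.inl ⟨hx, hb⟩
          · exact Or.inr hb)
    _ ≤ (Measure.pi fun _ : Fin 2 => coneMeasure) (Pre ∩ B) + (Measure.pi fun _ : Fin 2 => coneMeasure) Bᶜ := measure_union_le _ _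
    _ = (Measure.pi fun _ : Fin 2 => coneMeasure) (Pre ∩ B) := by rw [pi_coneMeasure_compl_piBall_two, add_zero]
    _ ≤ _ := (measure_mono hsub).trans (pi_cone_constraints_le h₃ hr ht hK)

end HaarSide


end Summit.QuantumFields.YangMills.Theorems.SwapVirialDeficit.SigmaTwistedCeiling

end
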